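import Mathlib
import HarnessLib
import Summits.NavierStokesRegularity.NavierStokesRegularity.Theorems.UnthreadedDoorKinematicShadowZonalCalculus
import Summits.NavierStokesRegularity.NavierStokesRegularity.Theorems.UnthreadedDoorKinematicShadowZonalBricks
import Summits.NavierStokesRegularity.NavierStokesRegularity.Theorems.UnthreadedDoorKinematicShadowPointSourceCalculus
import Summits.NavierStokesRegularity.NavierStokesRegularity.Theorems.ThreadingFluxHorizonTowerZonalFrame

/-!
# Route `UnthreadedDoor`, crux `PoloidalLiouville` (stmt-NavierStokesRegularity-1222), WALL W1 — crux idea «kinematic-shadow»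
# (ns-idea-15, `Cruxes/PoloidalLiouville/KinematicShadowSketch.lean` v1.2): zonal sub-rung A_z, Stage 1c — THE MERIDIAN / POLAR FRAME

ARM A (ns-exp-scalarLiouville g5), KEY-NS 02:19Z (2).  For the zonal potential `Z(x) = t(c(x))`, `c(x) = ⟪x − x₀, e⟫/‖x − x₀‖`, every
proof of `KinematicShadow.HomogeneousZonalToroidalNeverSteady` is written in the polar frame of an orthonormal pair `e ⊥ n`:
`e_r(θ) = cos θ e + sin θ n`, `e_θ(θ) = cos θ n − sin θ e`, `b = e × n`, and the meridian chart `X(r, θ) = x₀ + r e_r(θ)`.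
This file lands the frame algebra and the chart calculus (all elementary, stated WITHOUT new definitions — the frame vectors are
spelled out):
* `norm_polarVec`, `norm_polarVec'`, `inner_polarVec_polarVec'`, `cross_polarVec_polarVec'` — `(e_r, e_θ, b)` is a positively oriented
  orthonormal frame; `cross_axis_polarVec : e × e_r = sin θ b`; decompositions of `e`, `n` in the frame;
* `hasDerivAt_polarVec`, `hasDerivAt_polarVec'` — `∂_θ e_r = e_θ`, `∂_θ e_θ = −e_r`;
* chart facts: `‖X − x₀‖ = r`, `c(X) = cos θ`, `∇c(X) = −(sin θ / r) e_θ` (`gradient_axisCos_chart`), `∇Z(X) = −(t′(cos θ) sin θ / r) e_θ`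
  (`gradient_zonal_chart`), `e × (X − x₀) = (r sin θ) b` (`cross_axis_chart`), `ΔZ(X) = r⁻² ΔZ(x₀ + e_r(θ))` and independence of the
  choice of `n` (`laplacian_zonal_chart`, from ns-qj-p1's bricks `laplacian_zonal_dilate` / `laplacian_zonal_eq_of_reflect`);
* chain rules along curves (`hasDerivAt_comp_curve`, `hasDerivAt_inner_field_curve`) and the divergence in the frame
  (`divergence_polarFrame`: `div u = ⟪Du e_r, e_r⟫ + ⟪Du e_θ, e_θ⟫ + ⟪Du b, b⟫`, via `HorizonTower.Zonal.frameBasis`).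

HONEST LABEL: coordinate bookkeeping for an information-grade no-go in the LINEAR kinematic shadow (critic V20); 1222 / W1 / NS regularity
OPEN; nothing here is an NS statement.  `--supports stmt-NavierStokesRegularity-1222 --as helper`.
-/

noncomputable section

-- the summit and its single sub-problem share the name (CONVENTIONS §1)
set_option linter.dupNamespace false

open Set Function Filter Topology InnerProductSpace
open scoped RealInnerProductSpace Laplacian

namespace Summit.NavierStokesRegularity.NavierStokesRegularity.Theorems.PoloidalLiouville.KinematicShadow

open Literature.Analysis Literature.Analysis.FluidPDE
open Summit.NavierStokesRegularity.NavierStokesRegularity.Theorems.PoloidalLiouville.NetFlux (E3)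
open Summit.NavierStokesRegularity.NavierStokesRegularity.Theorems.PoloidalLiouville.HorizonTower.Zonal
  (norm_cross_sq inner_cross_self_left inner_cross_self_right cross_cross_left_of_orthonormal frameBasis frameBasis_apply
    frameVec_zero frameVec_one frameVec_two)

variable {x₀ e n p q : E3}

/-! ### The orthonormal frame of a pair `p ⊥ q` rotated by `θ` -/

/-- `‖cos θ p + sin θ q‖ = 1` for an orthonormal pair. [folklore] -/
theorem norm_polarVec (hp : ‖p‖ = 1) (hq : ‖q‖ = 1) (hpq : ⟪p, q⟫ = 0) (θ : ℝ) :
    ‖Real.cos θ • p + Real.sin θ • q‖ = 1 := by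
  have h : ‖Real.cos θ • p + Real.sin θ • q‖ ^ 2 = 1 ^ 2 := by
    rw [norm_add_sq_real, norm_smul, norm_smul, real_inner_smul_left, real_inner_smul_right, hpq, hp, hq,
      Real.norm_eq_abs, Real.norm_eq_abs, mul_one, mul_one, sq_abs, sq_abs]
    nlinarith [Real.cos_sq_add_sin_sq θ]
  exact (sq_eq_sq₀ (norm_nonneg _) zero_le_one).mp h

/-- `‖cos θ q − sin θ p‖ = 1` for an orthonormal pair. [folklore] -/
theorem norm_polarVec' (hp : ‖p‖ = 1) (hq : ‖q‖ = 1) (hpq : ⟪p, q⟫ = 0) (θ : ℝ) :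
    ‖Real.cos θ • q - Real.sin θ • p‖ = 1 := by
  have h : ‖Real.cos θ • q - Real.sin θ • p‖ ^ 2 = 1 ^ 2 := by
    rw [norm_sub_sq_real, norm_smul, norm_smul, real_inner_smul_left, real_inner_smul_right, real_inner_comm, hpq, hp,
      hq, Real.norm_eq_abs, Real.norm_eq_abs, mul_one, mul_one, sq_abs, sq_abs]
    nlinarith [Real.cos_sq_add_sin_sq θ]
  exact (sq_eq_sq₀ (norm_nonneg _) zero_le_one).mp h

/-- `cos θ p + sin θ q ⊥ cos θ q − sin θ p`. [folklore] -/
theorem inner_polarVec_polarVec' (hp : ‖p‖ = 1) (hq : ‖q‖ = 1) (hpq : ⟪p, q⟫ = 0) (θ : ℝ) :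
    ⟪Real.cos θ • p + Real.sin θ • q, Real.cos θ • q - Real.sin θ • p⟫ = 0 := by
  have hqp : ⟪q, p⟫ = 0 := by rw [real_inner_comm, hpq]
  simp only [inner_add_left, inner_sub_right, real_inner_smul_left, real_inner_smul_right, hpq, hqp,
    real_inner_self_eq_norm_sq, hp, hq]
  ring

/-- `⟪cos θ p + sin θ q, p⟫ = cos θ`. [folklore] -/
theorem inner_polarVec_fst (hp : ‖p‖ = 1) (hpq : ⟪p, q⟫ = 0) (θ : ℝ) :
    ⟪Real.cos θ • p + Real.sin θ • q, p⟫ = Real.cos θ := by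
  have hqp : ⟪q, p⟫ = 0 := by rw [real_inner_comm, hpq]
  simp [inner_add_left, real_inner_smul_left, hqp, hp]

/-- `⟪cos θ p + sin θ q, q⟫ = sin θ`. [folklore] -/
theorem inner_polarVec_snd (hq : ‖q‖ = 1) (hpq : ⟪p, q⟫ = 0) (θ : ℝ) :
    ⟪Real.cos θ • p + Real.sin θ • q, q⟫ = Real.sin θ := by
  simp [inner_add_left, real_inner_smul_left, hpq, hq]

/-- `⟪cos θ q − sin θ p, p⟫ = −sin θ`. [folklore] -/
theorem inner_polarVec'_fst (hp : ‖p‖ = 1) (hpq : ⟪p, q⟫ = 0) (θ : ℝ) :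
    ⟪Real.cos θ • q - Real.sin θ • p, p⟫ = -Real.sin θ := by
  have hqp : ⟪q, p⟫ = 0 := by rw [real_inner_comm, hpq]
  simp [inner_sub_left, real_inner_smul_left, hqp, hp]

/-- `⟪cos θ q − sin θ p, q⟫ = cos θ`. [folklore] -/
theorem inner_polarVec'_snd (hq : ‖q‖ = 1) (hpq : ⟪p, q⟫ = 0) (θ : ℝ) :
    ⟪Real.cos θ • q - Real.sin θ • p, q⟫ = Real.cos θ := by
  simp [inner_sub_left, real_inner_smul_left, hpq, hq]

/-- Frame decomposition of the first vector: `p = cos θ e_r − sin θ e_θ`. [folklore] -/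
theorem fst_eq_polarFrame (p q : E3) (θ : ℝ) :
    p = Real.cos θ • (Real.cos θ • p + Real.sin θ • q) - Real.sin θ • (Real.cos θ • q - Real.sin θ • p) := by
  ext i
  simp only [PiLp.sub_apply, PiLp.add_apply, PiLp.smul_apply, smul_eq_mul]
  linear_combination (-(p i)) * Real.cos_sq_add_sin_sq θ

/-- Frame decomposition of the second vector: `q = sin θ e_r + cos θ e_θ`. [folklore] -/
theorem snd_eq_polarFrame (p q : E3) (θ : ℝ) :
    q = Real.sin θ • (Real.cos θ • p + Real.sin θ • q) + Real.cos θ • (Real.cos θ • q - Real.sin θ • p) := by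
  ext i
  simp only [PiLp.sub_apply, PiLp.add_apply, PiLp.smul_apply, smul_eq_mul]
  linear_combination (-(q i)) * Real.cos_sq_add_sin_sq θ

/-- `p − cos θ e_r = −sin θ e_θ`. [folklore] -/
theorem fst_sub_cos_smul_polarVec (p q : E3) (θ : ℝ) :
    p - Real.cos θ • (Real.cos θ • p + Real.sin θ • q) = (-Real.sin θ) • (Real.cos θ • q - Real.sin θ • p) := by
  ext i
  simp only [PiLp.sub_apply, PiLp.add_apply, PiLp.smul_apply, smul_eq_mul]
  linear_combination (-(p i)) * Real.cos_sq_add_sin_sq θ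

/-- `∂_θ (cos θ p + sin θ q) = cos θ q − sin θ p`. [folklore] -/
theorem hasDerivAt_polarVec (p q : E3) (θ : ℝ) :
    HasDerivAt (fun θ : ℝ => Real.cos θ • p + Real.sin θ • q) (Real.cos θ • q - Real.sin θ • p) θ := by
  have h : HasDerivAt (fun θ : ℝ => Real.cos θ • p + Real.sin θ • q) ((-Real.sin θ) • p + Real.cos θ • q) θ :=
    ((Real.hasDerivAt_cos θ).smul_const p).add ((Real.hasDerivAt_sin θ).smul_const q)
  exact h.congr_deriv (by rw [neg_smul, add_comm, sub_eq_add_neg])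

/-- `∂_θ (cos θ q − sin θ p) = −(cos θ p + sin θ q)`. [folklore] -/
theorem hasDerivAt_polarVec' (p q : E3) (θ : ℝ) :
    HasDerivAt (fun θ : ℝ => Real.cos θ • q - Real.sin θ • p) (-(Real.cos θ • p + Real.sin θ • q)) θ := by
  have h : HasDerivAt (fun θ : ℝ => Real.cos θ • q - Real.sin θ • p) ((-Real.sin θ) • q - Real.cos θ • p) θ :=
    ((Real.hasDerivAt_cos θ).smul_const q).sub ((Real.hasDerivAt_sin θ).smul_const p)
  exact h.congr_deriv (by rw [neg_smul, neg_add, sub_eq_add_neg, add_comm])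

/-! ### Cross products in the frame (`b = e × n`) -/

/-- `‖e × n‖ = 1` for an orthonormal pair. [folklore] -/
theorem norm_cross_of_orthonormal (he : ‖e‖ = 1) (hn : ‖n‖ = 1) (hen : ⟪e, n⟫ = 0) : ‖cross e n‖ = 1 := by
  have h : ‖cross e n‖ ^ 2 = 1 ^ 2 := by rw [norm_cross_sq, he, hn, hen]; norm_num
  exact (sq_eq_sq₀ (norm_nonneg _) zero_le_one).mp h

/-- `e × (e × n) = −n` for an orthonormal pair. [folklore] -/
theorem cross_self_cross_of_orthonormal (he : ‖e‖ = 1) (hen : ⟪e, n⟫ = 0) : cross e (cross e n) = -n := by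
  rw [PointSource.cross_anticomm, cross_cross_left_of_orthonormal he hen]

/-- `e × e_r(θ) = sin θ (e × n)`. [folklore] -/
theorem cross_axis_polarVec (e n : E3) (θ : ℝ) :
    cross e (Real.cos θ • e + Real.sin θ • n) = Real.sin θ • cross e n := by
  rw [PointSource.cross_add_right, PointSource.cross_smul_right, PointSource.cross_smul_right, PointSource.cross_self,
    smul_zero, zero_add]

/-- `e_r × e_θ = e × n`: the frame `(e_r, e_θ, e × n)` is positively oriented. [folklore] -/
theorem cross_polarVec_polarVec' (e n : E3) (θ : ℝ) :
    cross (Real.cos θ • e + Real.sin θ • n) (Real.cos θ • n - Real.sin θ • e) = cross e n := by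
  have h1 : cross (Real.cos θ • e + Real.sin θ • n) n = Real.cos θ • cross e n := by
    rw [PointSource.cross_anticomm, PointSource.cross_add_right, PointSource.cross_smul_right,
      PointSource.cross_smul_right, PointSource.cross_self, smul_zero, add_zero, PointSource.cross_anticomm n e, smul_neg,
      neg_neg]
  have h2 : cross (Real.cos θ • e + Real.sin θ • n) e = -(Real.sin θ • cross e n) := by
    rw [PointSource.cross_anticomm, cross_axis_polarVec]
  rw [sub_eq_add_neg, PointSource.cross_add_right, PointSource.cross_smul_right, h1, ← neg_smul,
    PointSource.cross_smul_right, h2, smul_smul, smul_neg, smul_smul, ← sub_eq_add_neg, ← sub_smul]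
  have : Real.cos θ * Real.cos θ - -Real.sin θ * Real.sin θ = 1 := by nlinarith [Real.cos_sq_add_sin_sq θ]
  rw [this, one_smul]

/-- `e_r ⊥ e × n`. [folklore] -/
theorem inner_polarVec_cross (e n : E3) (θ : ℝ) : ⟪Real.cos θ • e + Real.sin θ • n, cross e n⟫ = 0 := by
  have h1 : ⟪e, cross e n⟫ = 0 := by rw [real_inner_comm]; exact inner_cross_self_left e n
  have h2 : ⟪n, cross e n⟫ = 0 := by rw [real_inner_comm]; exact inner_cross_self_right e n
  simp [inner_add_left, real_inner_smul_left, h1, h2]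

/-- `e_θ ⊥ e × n`. [folklore] -/
theorem inner_polarVec'_cross (e n : E3) (θ : ℝ) : ⟪Real.cos θ • n - Real.sin θ • e, cross e n⟫ = 0 := by
  have h1 : ⟪e, cross e n⟫ = 0 := by rw [real_inner_comm]; exact inner_cross_self_left e n
  have h2 : ⟪n, cross e n⟫ = 0 := by rw [real_inner_comm]; exact inner_cross_self_right e n
  simp [inner_sub_left, real_inner_smul_left, h1, h2]

/-! ### The meridian chart `X(r, θ) = x₀ + r e_r(θ)` -/

/-- `‖(x₀ + r v) − x₀‖ = r` for a unit vector `v` and `r ≥ 0`. [folklore] -/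
theorem norm_chart_sub {v : E3} (hv : ‖v‖ = 1) {r : ℝ} (hr : 0 ≤ r) : ‖x₀ + r • v - x₀‖ = r := by
  rw [add_sub_cancel_left, norm_smul, hv, mul_one, Real.norm_eq_abs, abs_of_nonneg hr]

/-- `x₀ + r v ≠ x₀` for a unit vector `v` and `r ≠ 0`. [folklore] -/
theorem chart_ne {v : E3} (hv : ‖v‖ = 1) {r : ℝ} (hr : r ≠ 0) : x₀ + r • v ≠ x₀ := by
  intro h
  have : r • v = 0 := by simpa using h
  rcases smul_eq_zero.1 this with h | h
  · exact hr h
  · rw [h, norm_zero] at hv; exact zero_ne_one hv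

/-- The axis cosine on the chart: `c(x₀ + r e_r(θ)) = cos θ` (`r > 0`). [folklore] -/
theorem axisCos_chart (he : ‖e‖ = 1) (hn : ‖n‖ = 1) (hen : ⟪e, n⟫ = 0) {r : ℝ} (hr : 0 < r) (θ : ℝ) :
    ⟪x₀ + r • (Real.cos θ • e + Real.sin θ • n) - x₀, e⟫ / ‖x₀ + r • (Real.cos θ • e + Real.sin θ • n) - x₀‖ = Real.cos θ := by
  rw [norm_chart_sub (norm_polarVec he hn hen θ) hr.le, add_sub_cancel_left, real_inner_smul_left,
    inner_polarVec_fst he hen, mul_div_cancel_left₀ _ hr.ne']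

/-- **`∇c` on the chart**: `∇c(x₀ + r e_r(θ)) = −(sin θ / r) e_θ(θ)`. [folklore] -/
theorem gradient_axisCos_chart (he : ‖e‖ = 1) (hn : ‖n‖ = 1) (hen : ⟪e, n⟫ = 0) {r : ℝ} (hr : 0 < r) (θ : ℝ) :
    gradient (fun z : E3 => ⟪z - x₀, e⟫ / ‖z - x₀‖) (x₀ + r • (Real.cos θ • e + Real.sin θ • n)) =
      (-(Real.sin θ / r)) • (Real.cos θ • n - Real.sin θ • e) := by
  have hv := norm_polarVec he hn hen θ
  rw [gradient_zonalCos e (chart_ne hv hr.ne'), norm_chart_sub hv hr.le, add_sub_cancel_left, real_inner_smul_left,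
    inner_polarVec_fst he hen, smul_smul]
  have h3 : r * Real.cos θ * (r ^ 3)⁻¹ * r = r⁻¹ * Real.cos θ := by field_simp
  rw [h3, mul_smul, ← smul_sub, fst_sub_cos_smul_polarVec, smul_smul]
  congr 1
  rw [div_eq_inv_mul, neg_mul_eq_mul_neg]

/-- **`∇Z` on the chart**: `∇Z(x₀ + r e_r(θ)) = −(t′(cos θ) sin θ / r) e_θ(θ)` for `Z = t ∘ c`. [folklore] -/
theorem gradient_zonal_chart (t : ℝ → ℝ) (he : ‖e‖ = 1) (hn : ‖n‖ = 1) (hen : ⟪e, n⟫ = 0) {r : ℝ} (hr : 0 < r) (θ : ℝ)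
    (ht : DifferentiableAt ℝ t (Real.cos θ)) :
    gradient (fun z : E3 => t (⟪z - x₀, e⟫ / ‖z - x₀‖)) (x₀ + r • (Real.cos θ • e + Real.sin θ • n)) =
      (-(deriv t (Real.cos θ) * Real.sin θ / r)) • (Real.cos θ • n - Real.sin θ • e) := by
  have hv := norm_polarVec he hn hen θ
  have hx := chart_ne (x₀ := x₀) hv hr.ne'
  have hc := axisCos_chart (x₀ := x₀) he hn hen hr θ
  have ht' : HasDerivAt t (deriv t (Real.cos θ))
      (⟪x₀ + r • (Real.cos θ • e + Real.sin θ • n) - x₀, e⟫ / ‖x₀ + r • (Real.cos θ • e + Real.sin θ • n) - x₀‖) := by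
    rw [hc]; exact ht.hasDerivAt
  rw [(hasGradientAt_zonal t x₀ e hx ht').gradient, ← (hasGradientAt_axisCos x₀ e hx).gradient,
    gradient_axisCos_chart he hn hen hr θ, smul_smul]
  congr 1
  ring

/-- `e × (X − x₀) = (r sin θ) (e × n)` on the chart. [folklore] -/
theorem cross_axis_chart (e n : E3) (r θ : ℝ) :
    cross e (x₀ + r • (Real.cos θ • e + Real.sin θ • n) - x₀) = (r * Real.sin θ) • cross e n := by
  rw [add_sub_cancel_left, PointSource.cross_smul_right, cross_axis_polarVec, smul_smul]

/-- **`ΔZ` on the chart**: `ΔZ(x₀ + r e_r(θ)) = r⁻² ΔZ(x₀ + cos θ e + sin θ n₀)` for ANY two unit vectors `n, n₀ ⊥ e`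
(`ΔZ` is `(−2)`-homogeneous and zonal — ns-qj-p1's bricks). [folklore] -/
theorem laplacian_zonal_chart (t : ℝ → ℝ) {n₀ : E3} (he : ‖e‖ = 1) (hn : ‖n‖ = 1) (hen : ⟪e, n⟫ = 0) (hn₀ : ‖n₀‖ = 1)
    (hen₀ : ⟪e, n₀⟫ = 0) {r : ℝ} (hr : 0 < r) (θ : ℝ) :
    Δ (fun w : E3 => t (⟪w - x₀, e⟫ / ‖w - x₀‖)) (x₀ + r • (Real.cos θ • e + Real.sin θ • n)) =
      (r ^ 2)⁻¹ * Δ (fun w : E3 => t (⟪w - x₀, e⟫ / ‖w - x₀‖)) (x₀ + (Real.cos θ • e + Real.sin θ • n₀)) := by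
  rw [laplacian_zonal_dilate t x₀ e _ hr, smul_eq_mul]
  congr 1
  apply laplacian_zonal_eq_of_reflect
  · rw [add_sub_cancel_left, add_sub_cancel_left, norm_polarVec he hn hen, norm_polarVec he hn₀ hen₀]
  · rw [add_sub_cancel_left, add_sub_cancel_left, inner_polarVec_fst he hen, inner_polarVec_fst he hen₀]

/-! ### Chain rules along curves and the divergence in the frame -/

/-- Chain rule along a curve for a scalar field: `d/ds F(γ(s)) = ⟪∇F(γ(s)), γ′(s)⟫`. [folklore] -/
theorem hasDerivAt_comp_curve {F : E3 → ℝ} {γ : ℝ → E3} {γ' : E3} {s : ℝ} (hF : DifferentiableAt ℝ F (γ s))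
    (hγ : HasDerivAt γ γ' s) : HasDerivAt (fun σ => F (γ σ)) ⟪gradient F (γ s), γ'⟫ s := by
  rw [FluidPDE.inner_gradient_left]
  exact hF.hasFDerivAt.comp_hasDerivAt s hγ

/-- Chain rule for a frame component of a vector field along a curve:
`d/ds ⟪u(γ(s)), w(s)⟫ = ⟪Du(γ(s)) γ′(s), w(s)⟫ + ⟪u(γ(s)), w′(s)⟫`. [folklore] -/
theorem hasDerivAt_inner_field_curve {u : E3 → E3} {γ w : ℝ → E3} {γ' w' : E3} {s : ℝ}
    (hu : DifferentiableAt ℝ u (γ s)) (hγ : HasDerivAt γ γ' s) (hw : HasDerivAt w w' s) :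
    HasDerivAt (fun σ => ⟪u (γ σ), w σ⟫) (⟪fderiv ℝ u (γ s) γ', w s⟫ + ⟪u (γ s), w'⟫) s := by
  have h1 : HasDerivAt (fun σ => u (γ σ)) (fderiv ℝ u (γ s) γ') s := hu.hasFDerivAt.comp_hasDerivAt s hγ
  exact (h1.inner ℝ hw).congr_deriv (add_comm _ _)

/-- Radial chart line: `d/dr (x₀ + r v) = v`. [folklore] -/
theorem hasDerivAt_chart_radius (x₀ v : E3) (r : ℝ) : HasDerivAt (fun ρ : ℝ => x₀ + ρ • v) v r := by
  have h := ((hasDerivAt_id r).smul_const v).const_add x₀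
  simpa using h

/-- Angular chart circle: `d/dθ (x₀ + r e_r(θ)) = r e_θ(θ)`. [folklore] -/
theorem hasDerivAt_chart_angle (x₀ p q : E3) (r θ : ℝ) :
    HasDerivAt (fun θ : ℝ => x₀ + r • (Real.cos θ • p + Real.sin θ • q)) (r • (Real.cos θ • q - Real.sin θ • p)) θ :=
  ((hasDerivAt_polarVec p q θ).const_smul r).const_add x₀

/-- **The divergence in the polar frame**: `div u(x) = ⟪Du e_r, e_r⟫ + ⟪Du e_θ, e_θ⟫ + ⟪Du b, b⟫`, `b = e × n`. [folklore] -/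
theorem divergence_polarFrame (he : ‖e‖ = 1) (hn : ‖n‖ = 1) (hen : ⟪e, n⟫ = 0) (θ : ℝ) (u : E3 → E3) (x : E3) :
    VectorCalculus.divergence u x =
      ⟪fderiv ℝ u x (Real.cos θ • e + Real.sin θ • n), Real.cos θ • e + Real.sin θ • n⟫ +
        ⟪fderiv ℝ u x (Real.cos θ • n - Real.sin θ • e), Real.cos θ • n - Real.sin θ • e⟫ +
          ⟪fderiv ℝ u x (cross e n), cross e n⟫ := by
  have h1 := norm_polarVec he hn hen θ
  have h2 := norm_polarVec' he hn hen θ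
  have h12 := inner_polarVec_polarVec' he hn hen θ
  rw [divergence_eq_sum_inner_fderiv (frameBasis h1 h2 h12) u x, Fin.sum_univ_three, frameBasis_apply, frameBasis_apply,
    frameBasis_apply, frameVec_zero, frameVec_one, frameVec_two, cross_polarVec_polarVec', real_inner_comm,
    real_inner_comm (cross e n), real_inner_comm (Real.cos θ • n - Real.sin θ • e)]

end Summit.NavierStokesRegularity.NavierStokesRegularity.Theorems.PoloidalLiouville.KinematicShadow

end
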